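import Literature.Probability.Percolation.Percolation
import HarnessLib

/-!
# Percolation of the finite clusters: `p_fin`, shielded paths, `p_c < p_fin` in high dimension

Topic `Literature/Probability/Percolation`. NAMED FACTS filed by a grounder for the crux
`Summit.CriticalPhenomena.PercolationContinuityZ3.Theses.PercBurnResprinkle.VacantSetPercolates`
(item `stmt-CriticalPhenomena-7205`: for bond percolation on `ℤ³` there is `p > p_c` at which the
origin lies with positive probability in an infinite connected component of the subgraph of `ℤ³`
induced on the vacant set `X = {y : C(y) finite}`), which is the `d = 3` case of the question
"`p_c(d) < p_fin(d)`?" of Grimmett–Holroyd–Kozma (open for `3 ≤ d ≤ 9`). What IS in print is the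
high-dimensional answer, vendored here as hypotheses other routes may take:

* `finiteClustersConfig G ω` — the graph `X` of [GHK14, §2] as a bond configuration: ALL edges of
  `G` both of whose endpoints lie in no infinite open cluster of `ω` ("We turn `X` into a graph by
  adding all edges of `𝔼^d` with both endpoints in `X`"); literally the set-builder used inline by
  the route item.
* `finiteClustersPercolate G` — the event `T = {X has an infinite connected component}`.
* `pFin d = sup {p ∈ [0,1] : P_p(T) > 0}` ([BDNS20, (1.2)]; [GHK14, (2.2)] defines it as the
  threshold with `P_p(T) = 1` for `p < p_fin`, `= 0` for `p > p_fin` — the same number by the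
  zero–one law for translation-invariant events, [GHK14, §2]).
* `IsShielded ω x` (every edge of `G` at `x` is closed), `shieldedPathsPercolate G` (there is an
  infinite self-avoiding path of `G` all of whose vertices are shielded) and
  `pShield d = sup {p ∈ [0,1] : P_p(∃ an infinite shielded path) > 0}` ([BDNS20, (1.3)]).
* `GrimmettHolroydKozma2014_Thm_1` — "For `d ≥ 19`, we have the strict inequality `p_c < p_fin`."
* `BockEtAl2020_Cor_1_5` — "For `d ≥ 10`, `p_c(d) < p_shield(d) ≤ p_fin(d)`."

## Faithfulness / design

* `p_c` is the tree's `criticalProb (zdGraph d) 0` (Grimmett's `p_c(d)` of bond percolation on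
  `𝕃^d`; both sources: "Let `p_c = p_c(d)` denote the critical probability of bond percolation on
  `𝕃^d`").
* The supremum is `sSup` over a subset of `[0,1] ⊆ ℝ` united with `{0}` (the set is bounded above
  by `1`; the `∪ {0}` only fixes the junk value of an empty supremum and changes nothing otherwise,
  all members being `≥ 0` — the same convention as the tree's `criticalProb`, which uses `∪ {1}`
  under an infimum).
* An "infinite path all of whose vertices are shielded" is rendered as an injective sequence
  `γ : ℕ → Site d` of consecutive `zdGraph`-neighbours with every `γ n` shielded.
* Consequence used by the route (NOT vendored as a fact, it is a short argument): `p_c < p_fin`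
  gives `p ∈ (p_c, p_fin)` with `P_p(T) > 0`, and translation invariance + a countable union turn
  "some vertex" into "the origin" — the shape of `VacantSetPercolates`, which however asks `d = 3`.

## Sources (read in the held texts, 2026-08-15)

* G. R. Grimmett, A. E. Holroyd, G. Kozma, *Percolation of finite clusters and infinite
  surfaces*, Math. Proc. Cambridge Philos. Soc. 156 (2014) 263–279, arXiv:1303.1657: §1 Theorem 1
  (p. 3 of the arXiv text: "For `d ≥ 19`, we have the strict inequality `p_c < p_fin`."; "We do not
  know whether or not `p_c < p_fin` for `3 ≤ d ≤ 18`."), §2 (definition of `X`, `T`, `p_fin`),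
  §4 Theorem 5 (the conditional statement from a one-arm bound `P_{p_c}(rad C ≥ n) ≤ c/n`).
  [GrimmettHolroydKozma2014]
* B. Bock, M. Damron, C. M. Newman, V. Sidoravicius, *Percolation of finite clusters and
  shielded paths*, J. Stat. Phys. 179 (2020) 789–807, arXiv:1811.01678: (1.2) `p_fin`, (1.3)
  `p_shield`, (1.4) `p_shield ≤ p_fin`, Corollary 1.5 (p. 4: "For `d ≥ 10`,
  `p_c(d) < p_shield(d) ≤ p_fin(d)`."); the text also records `p_c(d) < p_fin(d)` for `d ≥ 11`
  from GHK + Fitzner–van der Hofstad. [BockEtAl2020]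
-/

noncomputable section

open MeasureTheory

namespace Literature.Probability.Percolation

open Literature.Probability.LatticeModels

variable {V : Type*}

/-- The graph `X` of the finite clusters as a bond configuration: all edges of `G` both of whose
endpoints lie in NO infinite open cluster of `ω` (the subgraph of `G` induced on the vacant set
`X = {y : C(y) finite}`). [cite: GrimmettHolroydKozma2014, §2] -/
def finiteClustersConfig (G : SimpleGraph V) (ω : BondConfig V) : BondConfig V :=
  {e | e ∈ G.edgeSet ∧ ∀ y ∈ e, ¬ (openCluster ω y).Infinite}

/-- The event `T = {X has an infinite connected component}`: some vertex has an infinite cluster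
in the induced graph on the vacant set. [cite: GrimmettHolroydKozma2014, §2] -/
def finiteClustersPercolate (G : SimpleGraph V) : Set (BondConfig V) :=
  {ω | ∃ x : V, (openCluster (finiteClustersConfig G ω) x).Infinite}

/-- The complementary critical value `p_fin(d) = sup {p ∈ [0,1] : P_p(X has an infinite connected
component) > 0}` for bond percolation on `ℤ^d` (supremum in `ℝ`; `∪ {0}` guards the empty case
only). [cite: BockEtAl2020, (1.2)] -/
def pFin (d : ℕ) : ℝ :=
  sSup ({p : ℝ | ∃ h : p ∈ unitInterval,
    0 < (bondPercolation (zdGraph d) ⟨p, h⟩).real (finiteClustersPercolate (zdGraph d))} ∪ {0})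

/-- The vertex `x` is **shielded** in `ω` if all edges of `G` incident to `x` are closed.
[cite: BockEtAl2020, §1.1] -/
def IsShielded (G : SimpleGraph V) (ω : BondConfig V) (x : V) : Prop :=
  ∀ y : V, G.Adj x y → s(x, y) ∉ ω

/-- The event "there is an infinite shielded path": an injective sequence of consecutive
`G`-neighbours all of whose vertices are shielded. [cite: BockEtAl2020, §1.1] -/
def shieldedPathsPercolate (G : SimpleGraph V) : Set (BondConfig V) :=
  {ω | ∃ γ : ℕ → V, Function.Injective γ ∧ (∀ n, G.Adj (γ n) (γ (n + 1))) ∧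
    ∀ n, IsShielded G ω (γ n)}

/-- The shielded critical probability
`p_shield(d) = sup {p ∈ [0,1] : P_p(∃ an infinite shielded path) > 0}` for bond percolation on
`ℤ^d`. [cite: BockEtAl2020, (1.3)] -/
def pShield (d : ℕ) : ℝ :=
  sSup ({p : ℝ | ∃ h : p ∈ unitInterval,
    0 < (bondPercolation (zdGraph d) ⟨p, h⟩).real (shieldedPathsPercolate (zdGraph d))} ∪ {0})

/-- NAMED FACT — **Grimmett–Holroyd–Kozma 2014, Theorem 1**: "For `d ≥ 19`, we have the strict
inequality `p_c < p_fin`." (bond percolation on `𝕃^d`; proved from the Kozma–Nachmias one-arm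
exponent via their Theorem 5). Users take `(h : GrimmettHolroydKozma2014_Thm_1)`; recorded while
grounding `Summit.CriticalPhenomena.PercolationContinuityZ3.Theses.PercBurnResprinkle.VacantSetPercolates`
(which is the open `d = 3` case). [cite: GrimmettHolroydKozma2014, Thm 1] -/
def GrimmettHolroydKozma2014_Thm_1 : Prop :=
  ∀ d : ℕ, 19 ≤ d → criticalProb (zdGraph d) 0 < pFin d

/-- NAMED FACT — **Bock–Damron–Newman–Sidoravicius 2020, Corollary 1.5**: "For `d ≥ 10`,
`p_c(d) < p_shield(d) ≤ p_fin(d)`." (shielded percolation; elementary, not via the triangle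
condition). Users take `(h : BockEtAl2020_Cor_1_5)`; grounds (in dimension `≥ 10` only) the shape
of `Summit.CriticalPhenomena.PercolationContinuityZ3.Theses.PercBurnResprinkle.VacantSetPercolates`.
[cite: BockEtAl2020, Cor 1.5] -/
def BockEtAl2020_Cor_1_5 : Prop :=
  ∀ d : ℕ, 10 ≤ d → criticalProb (zdGraph d) 0 < pShield d ∧ pShield d ≤ pFin d

/-! ### Sanity API (definitional unfolding only) -/

/-- Membership in the finite-clusters configuration, unfolded. [cite: GrimmettHolroydKozma2014, §2] -/
theorem mem_finiteClustersConfig (G : SimpleGraph V) (ω : BondConfig V) (e : Sym2 V) :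
    e ∈ finiteClustersConfig G ω ↔ e ∈ G.edgeSet ∧ ∀ y ∈ e, ¬ (openCluster ω y).Infinite :=
  Iff.rfl

/-- The finite-clusters configuration only uses edges of `G`. [cite: GrimmettHolroydKozma2014, §2] -/
theorem finiteClustersConfig_subset (G : SimpleGraph V) (ω : BondConfig V) :
    finiteClustersConfig G ω ⊆ G.edgeSet := fun _ he => he.1

/-- `0 ≤ p_fin(d)` (every member of the defining set is `≥ 0`, and `0` is adjoined).
[cite: BockEtAl2020, (1.2)] -/
theorem pFin_nonneg (d : ℕ) : 0 ≤ pFin d := by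
  refine le_csSup ?_ (Or.inr rfl)
  refine ⟨1, ?_⟩
  rintro p (⟨h, -⟩ | h)
  · exact h.2
  · rw [Set.mem_singleton_iff] at h; rw [h]; exact zero_le_one

/-- `p_fin(d) ≤ 1`. [cite: BockEtAl2020, (1.2)] -/
theorem pFin_le_one (d : ℕ) : pFin d ≤ 1 := by
  refine csSup_le ⟨0, Or.inr rfl⟩ ?_
  rintro p (⟨h, -⟩ | h)
  · exact h.2
  · rw [Set.mem_singleton_iff] at h; rw [h]; exact zero_le_one

/-- `0 ≤ p_shield(d)`. [cite: BockEtAl2020, (1.3)] -/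
theorem pShield_nonneg (d : ℕ) : 0 ≤ pShield d := by
  refine le_csSup ?_ (Or.inr rfl)
  refine ⟨1, ?_⟩
  rintro p (⟨h, -⟩ | h)
  · exact h.2
  · rw [Set.mem_singleton_iff] at h; rw [h]; exact zero_le_one

/-- `p_shield(d) ≤ 1`. [cite: BockEtAl2020, (1.3)] -/
theorem pShield_le_one (d : ℕ) : pShield d ≤ 1 := by
  refine csSup_le ⟨0, Or.inr rfl⟩ ?_
  rintro p (⟨h, -⟩ | h)
  · exact h.2
  · rw [Set.mem_singleton_iff] at h; rw [h]; exact zero_le_one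

end Literature.Probability.Percolation

end
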